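import Mathlib
import Literature.Computability.Complexity.ExtMonotoneGates
import Summits.PneNP.PneNP.Theorems.ConvexRankGatesCaptureSignedDefs

/-!
# Route ConvexRankGates, crux `Capture` (stmt-PneNP-2659): the SIGNED DOUBLE COVER — balance, switching and
the `𝔽₂`-span statement (unbalanced-cycle door, file 2/5)

Support theorems for the crux `Summit.PneNP.PneNP.Theses.ConvexRankGates.Capture` (lead c10). The disprover's open
one-gate question PQ asks whether `𝔽₂`-span membership (the abelian PERM door) is ONE GRANK gate. In the language of
binary matroids, a gate `v ↦ [t ∈ span {a_i : v_i = 1}]` is the PORT at `t` of the binary matroid `M = [A | t]`. Lead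
c8 settled the case `M ∖ t` graphic (T-joins). This file is the combinatorial half of the case `M / t` GRAPHIC: after
a change of basis `t = e₀` and the columns are `a_i = (o_i ; e_{p_i} + e_{q_i})`, i.e. the edges `p_i q_i` of a graph
on `V` carrying signs `o_i ∈ {0,1}` — a SIGNED GRAPH (Harary 1953; Zaslavsky 1982), the port being the even-cycle /
signed-graphic matroid's port at the sign element. Objects (`cover`, `Unbalanced`, `col`, `selGraph`) are those of
`ConvexRankGatesCaptureSignedDefs.lean`.

* `unbalanced_iff_not_exists_switching` — Harary's balance theorem in switching form: NOT unbalanced iff there is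
  `y : V → Bool` with `y (q i) = y (p i) ⊕ o i` on every selected wire (proof: the potential `z ↦ z.2 ⊕ y z.1` is
  constant along cover edges; conversely orient each pair `{C(u,0), C(u,1)}` of cover components by an enumeration).
* `unbalanced_iff_mem_span` (registered anchor) — the `𝔽₂` statement:
  `Unbalanced v ↔ (1, 0) ∈ span_{𝔽₂} {(o_i, e_{p_i} + e_{q_i}) : v_i = 1}` in `𝔽₂ × 𝔽₂^V` (walks telescope; a switching
  function is a linear functional killing the span but not `(1,0)`).
* `colorable_two_iff_not_unbalanced` — all signs odd, no loops: the selected subgraph is `2`-colourable iff it is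
  NOT unbalanced (so NON-BIPARTITENESS of the selected subgraph is the all-odd instance of the door).

Sources: F. Harary, On the notion of balance of a signed graph, Michigan Math. J. 2 (1953) 143–146 (balance ⟺
switching); T. Zaslavsky, Signed graphs, Discrete Appl. Math. 4 (1982) 47–74 (signed covering graph). No new
definitions. [folklore]
-/

namespace Summit.PneNP.PneNP.Theorems.Capture.Signed

set_option linter.dupNamespace false -- `Summit.PneNP.PneNP.…`: summit = sub-problem (D-0017)

open SimpleGraph Finset

variable {V : Type} {n : ℕ} {p q : Fin n → V} {o : Fin n → Bool}

/-- Selecting more wires only adds cover edges. [folklore] -/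
theorem cover_mono {v w : Fin n → Bool} (h : v ≤ w) : cover p q o v ≤ cover p q o w := by
  intro a b hab
  rw [cover_adj] at hab ⊢
  refine ⟨hab.1, ?_⟩
  rcases hab.2 with ⟨i, hi, h1⟩ | ⟨i, hi, h1⟩
  · exact Or.inl ⟨i, Literature.Computability.Complexity.eq_true_of_le_of_eq_true (h i) hi, h1⟩
  · exact Or.inr ⟨i, Literature.Computability.Complexity.eq_true_of_le_of_eq_true (h i) hi, h1⟩

/-- `Unbalanced` is monotone in the selection (the door is a MONOTONE Boolean function). [folklore] -/
theorem Unbalanced.mono {v w : Fin n → Bool} (h : v ≤ w) (hv : Unbalanced p q o v) : Unbalanced p q o w := by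
  obtain ⟨a, ha⟩ := hv
  exact ⟨a, ha.mono (cover_mono h)⟩

/-! ### Switching functions: Harary's balance theorem -/

/-- The potential `z ↦ z.2 ⊕ y z.1` of a switching function `y` is constant along cover edges. [folklore] -/
theorem pot_eq_of_adj {v : Fin n → Bool} {y : V → Bool}
    (hy : ∀ i, v i = true → y (q i) = (y (p i) ^^ o i)) {z z' : V × Bool} (h : (cover p q o v).Adj z z') :
    (z.2 ^^ y z.1) = (z'.2 ^^ y z'.1) := by
  rw [cover_adj] at h
  obtain ⟨z1, z2⟩ := z
  obtain ⟨z1', z2'⟩ := z'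
  rcases h.2 with ⟨i, hi, h1, h2, h3⟩ | ⟨i, hi, h1, h2, h3⟩
  · simp only at h1 h2 h3
    subst h1 h2 h3
    simp only [hy i hi]
    cases z2 <;> cases o i <;> cases y (p i) <;> rfl
  · simp only at h1 h2 h3
    subst h1 h2 h3
    simp only [hy i hi]
    cases z2' <;> cases o i <;> cases y (p i) <;> rfl

/-- The potential is constant along cover walks. [folklore] -/
theorem pot_eq_of_walk {v : Fin n → Bool} {y : V → Bool}
    (hy : ∀ i, v i = true → y (q i) = (y (p i) ^^ o i)) {z z' : V × Bool}
    (w : (cover p q o v).Walk z z') : (z.2 ^^ y z.1) = (z'.2 ^^ y z'.1) := by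
  induction w with
  | nil => rfl
  | cons hadj _ ih => exact (pot_eq_of_adj hy hadj).trans ih

/-- A switching function certifies balance: if `y (q i) = y (p i) ⊕ o i` on every selected wire then no vertex has
its two lifts connected (Harary 1953, easy direction). [folklore] -/
theorem not_unbalanced_of_switching {v : Fin n → Bool} {y : V → Bool}
    (hy : ∀ i, v i = true → y (q i) = (y (p i) ^^ o i)) : ¬ Unbalanced p q o v := by
  rintro ⟨a, ⟨w⟩⟩
  have h := pot_eq_of_walk hy w
  simp only at h
  cases hya : y a <;> simp [hya] at h

/-- Harary's balance theorem, hard direction: if no vertex has its two lifts connected, a switching function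
exists. Construction: enumerate the cover components injectively; `y u := [rank C(u,1) < rank C(u,0)]` orients
every pair `{C(u,0), C(u,1)}` consistently, because the two lifts of an even edge join like lifts and those of an odd
edge join opposite lifts. [folklore] -/
theorem exists_switching_of_not_unbalanced [Finite V] {v : Fin n → Bool} (h : ¬ Unbalanced p q o v) :
    ∃ y : V → Bool, ∀ i, v i = true → y (q i) = (y (p i) ^^ o i) := by
  classical
  set G := cover p q o v with hG
  haveI : Fintype G.ConnectedComponent := Fintype.ofFinite _
  obtain ⟨rk, hrk⟩ : ∃ rk : G.ConnectedComponent → ℕ, Function.Injective rk :=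
    ⟨fun c => (Fintype.equivFin _ c : ℕ), fun c c' hcc' => (Fintype.equivFin _).injective (Fin.ext hcc')⟩
  -- the two lifts of an edge end lie in the components dictated by the sign
  have key : ∀ i, v i = true → ∀ c : Bool,
      G.connectedComponentMk (q i, (c ^^ o i)) = G.connectedComponentMk (p i, c) := by
    intro i hi c
    rw [ConnectedComponent.eq]
    by_cases heq : ((q i, (c ^^ o i)) : V × Bool) = (p i, c)
    · rw [heq]
    · refine Adj.reachable ?_
      rw [hG, cover_adj]
      exact ⟨heq, Or.inr ⟨i, hi, rfl, rfl, rfl⟩⟩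
  have hne : ∀ a : V, rk (G.connectedComponentMk (a, false)) ≠ rk (G.connectedComponentMk (a, true)) :=
    fun a hc => h ⟨a, ConnectedComponent.exact (hrk hc)⟩
  refine ⟨fun u => decide (rk (G.connectedComponentMk (u, true)) < rk (G.connectedComponentMk (u, false))),
    fun i hi => ?_⟩
  have h0 := key i hi false
  have h1 := key i hi true
  cases ho : o i
  · simp only [ho, Bool.xor_false] at h0 h1
    simp only [h0, h1, Bool.xor_false]
  · simp only [ho, Bool.xor_true, Bool.not_false, Bool.not_true] at h0 h1
    simp only [h0, h1, Bool.xor_true]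
    rcases Nat.lt_or_gt_of_ne (hne (p i)) with hlt | hlt
    · simp [hlt, Nat.not_lt_of_gt hlt]
    · simp [hlt, Nat.not_lt_of_gt hlt]

/-- **Balance ⟺ switching** (Harary 1953): the selected signed subgraph is unbalanced iff NO switching function
`y` with `y (q i) = y (p i) ⊕ o i` on the selected wires exists. [folklore] -/
theorem unbalanced_iff_not_exists_switching [Finite V] {v : Fin n → Bool} :
    Unbalanced p q o v ↔ ¬ ∃ y : V → Bool, ∀ i, v i = true → y (q i) = (y (p i) ^^ o i) :=
  ⟨fun hu ⟨_, hy⟩ => not_unbalanced_of_switching hy hu,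
    fun hn => by_contra fun hu => hn (exists_switching_of_not_unbalanced hu)⟩

/-! ### The `𝔽₂`-span statement -/

/-- Characteristic two. [folklore] -/
theorem add_self_prod (x : ZMod 2 × (V → ZMod 2)) : x + x = 0 := by
  ext <;> simp [CharTwo.add_self_eq_zero]

/-- `Bool` addition read in `𝔽₂`. [folklore] -/
theorem bit_add_bit (a b : Bool) :
    ((if a then 1 else 0) + (if b then 1 else 0) : ZMod 2) = if (a ^^ b) then 1 else 0 := by
  cases a <;> cases b <;> decide


/-- The lifts of the two ends of a cover edge sum to a selected column. [folklore] -/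
theorem lift_add_lift_of_adj [DecidableEq V] {v : Fin n → Bool} {z z' : V × Bool}
    (h : (cover p q o v).Adj z z') :
    ((if z.2 then 1 else 0 : ZMod 2), (Pi.single z.1 (1 : ZMod 2) : V → ZMod 2)) +
        ((if z'.2 then 1 else 0 : ZMod 2), (Pi.single z'.1 (1 : ZMod 2) : V → ZMod 2)) ∈
      Submodule.span (ZMod 2) (col p q o '' {i | v i = true}) := by
  rw [cover_adj] at h
  obtain ⟨z1, z2⟩ := z
  obtain ⟨z1', z2'⟩ := z'
  rcases h.2 with ⟨i, hi, h1, h2, h3⟩ | ⟨i, hi, h1, h2, h3⟩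
  · simp only at h1 h2 h3
    subst h1 h2 h3
    have hc : ((if (p i, z2).2 then 1 else 0 : ZMod 2), (Pi.single (p i, z2).1 (1 : ZMod 2) : V → ZMod 2)) +
        ((if (q i, (z2 ^^ o i)).2 then 1 else 0 : ZMod 2),
          (Pi.single (q i, (z2 ^^ o i)).1 (1 : ZMod 2) : V → ZMod 2)) = col p q o i := by
      refine Prod.ext ?_ ?_
      · simp only [col, Prod.fst_add, bit_add_bit]
        have hb : (z2 ^^ (z2 ^^ o i)) = o i := by cases z2 <;> cases o i <;> rfl
        rw [hb]
      · simp only [col, Prod.snd_add]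
    rw [hc]
    exact Submodule.subset_span ⟨i, hi, rfl⟩
  · simp only at h1 h2 h3
    subst h1 h2 h3
    have hc : ((if (q i, (z2' ^^ o i)).2 then 1 else 0 : ZMod 2),
          (Pi.single (q i, (z2' ^^ o i)).1 (1 : ZMod 2) : V → ZMod 2)) +
        ((if (p i, z2').2 then 1 else 0 : ZMod 2), (Pi.single (p i, z2').1 (1 : ZMod 2) : V → ZMod 2)) =
          col p q o i := by
      refine Prod.ext ?_ ?_
      · simp only [col, Prod.fst_add, bit_add_bit]
        have hb : ((z2' ^^ o i) ^^ z2') = o i := by cases z2' <;> cases o i <;> rfl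
        rw [hb]
      · simp only [col, Prod.snd_add]
        exact add_comm _ _
    rw [hc]
    exact Submodule.subset_span ⟨i, hi, rfl⟩

/-- Walks telescope in characteristic two. [folklore] -/
theorem lift_add_lift_of_walk [DecidableEq V] {v : Fin n → Bool} {z z' : V × Bool}
    (w : (cover p q o v).Walk z z') :
    ((if z.2 then 1 else 0 : ZMod 2), (Pi.single z.1 (1 : ZMod 2) : V → ZMod 2)) +
        ((if z'.2 then 1 else 0 : ZMod 2), (Pi.single z'.1 (1 : ZMod 2) : V → ZMod 2)) ∈
      Submodule.span (ZMod 2) (col p q o '' {i | v i = true}) := by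
  induction w with
  | nil => rw [add_self_prod]; exact Submodule.zero_mem _
  | @cons a b c hadj _ ih =>
    have hsum : ((if a.2 then 1 else 0 : ZMod 2), (Pi.single a.1 (1 : ZMod 2) : V → ZMod 2)) +
          ((if c.2 then 1 else 0 : ZMod 2), (Pi.single c.1 (1 : ZMod 2) : V → ZMod 2)) =
        (((if a.2 then 1 else 0 : ZMod 2), (Pi.single a.1 (1 : ZMod 2) : V → ZMod 2)) +
          ((if b.2 then 1 else 0 : ZMod 2), (Pi.single b.1 (1 : ZMod 2) : V → ZMod 2))) +
        (((if b.2 then 1 else 0 : ZMod 2), (Pi.single b.1 (1 : ZMod 2) : V → ZMod 2)) +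
          ((if c.2 then 1 else 0 : ZMod 2), (Pi.single c.1 (1 : ZMod 2) : V → ZMod 2))) := by
      rw [add_assoc, ← add_assoc (((if b.2 then 1 else 0 : ZMod 2), (Pi.single b.1 (1 : ZMod 2) : V → ZMod 2))),
        add_self_prod, zero_add]
    rw [hsum]
    exact Submodule.add_mem _ (lift_add_lift_of_adj hadj) ih

/-- Walks telescope: an unbalanced selection puts `(1, 0)` into the `𝔽₂`-span of the selected columns. [folklore] -/
theorem mem_span_of_unbalanced [DecidableEq V] {v : Fin n → Bool} (h : Unbalanced p q o v) :
    ((1 : ZMod 2), (0 : V → ZMod 2)) ∈ Submodule.span (ZMod 2) (col p q o '' {i | v i = true}) := by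
  obtain ⟨a, ⟨w⟩⟩ := h
  have hw := lift_add_lift_of_walk w
  have hl : ((if (a, false).2 then 1 else 0 : ZMod 2), (Pi.single (a, false).1 (1 : ZMod 2) : V → ZMod 2)) +
      ((if (a, true).2 then 1 else 0 : ZMod 2), (Pi.single (a, true).1 (1 : ZMod 2) : V → ZMod 2)) =
        ((1 : ZMod 2), (0 : V → ZMod 2)) := by
    refine Prod.ext ?_ ?_
    · simp
    · simp only [Prod.snd_add]
      ext u
      simp [CharTwo.add_self_eq_zero]
  rwa [hl] at hw

/-- A switching function is a linear functional killing every selected column but not `(1, 0)`. [folklore] -/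
theorem not_mem_span_of_switching [Fintype V] [DecidableEq V] {v : Fin n → Bool} {y : V → Bool}
    (hy : ∀ i, v i = true → y (q i) = (y (p i) ^^ o i)) :
    ((1 : ZMod 2), (0 : V → ZMod 2)) ∉ Submodule.span (ZMod 2) (col p q o '' {i | v i = true}) := by
  classical
  let yy : V → ZMod 2 := fun u => if y u then 1 else 0
  -- the functional `(s, x) ↦ s + Σ_u ŷ_u x_u`
  let ℓ : (ZMod 2 × (V → ZMod 2)) →ₗ[ZMod 2] ZMod 2 :=
    LinearMap.fst (ZMod 2) (ZMod 2) (V → ZMod 2) +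
      (∑ u : V, yy u • LinearMap.proj u) ∘ₗ LinearMap.snd (ZMod 2) (ZMod 2) (V → ZMod 2)
  have hℓ : ∀ x : ZMod 2 × (V → ZMod 2), ℓ x = x.1 + ∑ u, yy u * x.2 u := by
    intro x
    simp [ℓ]
  have hs : ∀ a : V, ∑ u, yy u * (Pi.single a (1 : ZMod 2) : V → ZMod 2) u = yy a := by
    intro a
    rw [Finset.sum_eq_single a]
    · simp
    · intro b _ hb
      simp [hb]
    · simp
  have hker : Submodule.span (ZMod 2) (col p q o '' {i | v i = true}) ≤ LinearMap.ker ℓ := by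
    rw [Submodule.span_le]
    rintro x ⟨i, hi, rfl⟩
    simp only [Set.mem_setOf_eq] at hi
    rw [SetLike.mem_coe, LinearMap.mem_ker, hℓ]
    simp only [col, Pi.add_apply, mul_add, Finset.sum_add_distrib, hs]
    have hyq := hy i hi
    simp only [yy, hyq]
    cases o i <;> cases y (p i) <;> decide
  intro hmem
  have h0 := hker hmem
  rw [LinearMap.mem_ker, hℓ] at h0
  simp only [Pi.zero_apply, mul_zero, Finset.sum_const_zero, add_zero] at h0
  exact one_ne_zero h0

/-- **The `𝔽₂` statement of the door** (registered anchor): the selected signed subgraph is unbalanced iff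
`(1, 0) ∈ span_{𝔽₂} {(o_i ; e_{p_i} + e_{q_i}) : v_i = 1}` — i.e. the door IS the port of the binary matroid
`[(o_i ; e_{p_i}+e_{q_i})_i | e₀]` at `e₀`, the case "`M / t` graphic" of `𝔽₂`-span membership. [folklore] -/
theorem unbalanced_iff_mem_span : ∀ {V : Type} [Fintype V] [DecidableEq V] {n : ℕ} {p q : Fin n → V}
    {o : Fin n → Bool} {v : Fin n → Bool}, Unbalanced p q o v ↔
      ((1 : ZMod 2), (0 : V → ZMod 2)) ∈ Submodule.span (ZMod 2) (col p q o '' {i | v i = true}) := by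
  intro V _ _ n p q o v
  refine ⟨mem_span_of_unbalanced, fun hmem => ?_⟩
  by_contra hu
  obtain ⟨y, hy⟩ := exists_switching_of_not_unbalanced hu
  exact not_mem_span_of_switching hy hmem

/-! ### All signs odd: non-bipartiteness -/

/-- **Non-bipartiteness is the all-odd door**: for a loop-free edge list, the selected subgraph is `2`-colourable
iff, with every sign odd, it is NOT unbalanced (a `2`-colouring is exactly a switching function). [folklore] -/
theorem colorable_two_iff_not_unbalanced [Finite V] (hpq : ∀ i, p i ≠ q i) {v : Fin n → Bool} :
    (selGraph p q v).Colorable 2 ↔ ¬ Unbalanced p q (fun _ => true) v := by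
  constructor
  · intro hc
    let C : (selGraph p q v).Coloring Bool := hc.toColoring (by simp)
    refine not_unbalanced_of_switching (y := fun u => C u) fun i hi => ?_
    have hadj : (selGraph p q v).Adj (p i) (q i) := by
      rw [selGraph_adj]
      exact ⟨hpq i, Or.inl ⟨i, hi, rfl, rfl⟩⟩
    have hne := C.valid hadj
    revert hne
    cases C (p i) <;> cases C (q i) <;> simp
  · intro hu
    obtain ⟨y, hy⟩ := exists_switching_of_not_unbalanced hu
    have hval : ∀ {a b : V}, (selGraph p q v).Adj a b → y a ≠ y b := by
      intro a b hab
      rw [selGraph_adj] at hab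
      rcases hab.2 with ⟨i, hi, rfl, rfl⟩ | ⟨i, hi, rfl, rfl⟩
      · rw [hy i hi]
        cases y (p i) <;> simp
      · rw [hy i hi]
        cases y (p i) <;> simp
    have hcol := (Coloring.mk y hval).colorable
    simpa using hcol

end Summit.PneNP.PneNP.Theorems.Capture.Signed
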